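import Literature.AlgebraicGeometry.HodgeTheory.KunnethStandardConjectureProducts
import Literature.AlgebraicGeometry.HodgeTheory.KunnethComponentsDiagonalAction
import Literature.AlgebraicGeometry.HodgeTheory.KunnethComponentsDiagonalIsoInvariance
import Literature.AlgebraicGeometry.HodgeTheory.CurveCorrespondencePushforward
import Literature.AlgebraicGeometry.HodgeTheory.SurjectivePullbackAlgebraicClasses
import HarnessLib

/-!
# The Künneth standard conjecture descends along surjective equidimensional morphisms
# (Kahn, Lemma 6.30 (2): direct summands)

Family `hodge`, layer `Literature/AlgebraicGeometry/HodgeTheory`; namespace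
`Literature.AlgebraicGeometry.HodgeTheory`. Theorems only (no definition, no named fact, sorry-free).

B. Kahn, *Zeta and L-functions of varieties and motives* (2020), §6.9 Lemma 6.30 (2): "If `p^i_M` is
algebraic, then `p^i_{M'}` is algebraic for every direct summand `M'` of `M`" (proof: "`p^i_M` is central
in `End(H^*(M))` … so `p p^i_M` is still a projector; we see immediately that it is `p^i_{M'}`"). On the
tree's carriers the basic instance of a direct summand is a SURJECTIVE morphism `g : X ⟶ W` of smooth
projective complex varieties OF THE SAME DIMENSION `n`: `g_* g^* = c · Id` with `c ≠ 0` (Voisin I,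
Rem. 7.29 "`φ_* ∘ φ^* = N Id`"; the tree's `exists_complexGysin_map_eq_smul_of_surjective`), so that
`h(W)` is cut out of `h(X)` by the projector `c⁻¹ ᵗΓ_g ∘ Γ_g`, and the Künneth components of `cl(Δ_W)`
are `π_W i = c⁻¹ (g × g)_* π_X i` — push-forwards of those of `cl(Δ_X)`, hence algebraic (resp. of the
same coniveau) when those are. Everything is read through the ACTION of correspondences
(`corrAction`, second factor = source), with the push-forward rules of Fulton, *Intersection Theory*
Prop. 16.1.1 (b)–(c) / Def. 16.1.2:

* §1 **`corrAction_complexGysin_whiskerLeft`** — `((W ◁ g)_* γ')_* = γ'_* ∘ g^*` (push-forward of a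
  correspondence along its SOURCE factor; the source-side twin of the tree's
  `corrAction_complexGysin_whiskerRight`, `((g ▷ X)_* γ')_* = g_* ∘ γ'_*`), and
  **`corrAction_complexGysin_tensorHom`** — `((g₁ ⊗ g₂)_* γ)_* = g₁_* ∘ γ_* ∘ g₂^*`.
* §2 **`complexGysin_tensorHom_mem_kunnethPiece`** — `(g₁ ⊗ g₂)_*` maps the Künneth piece
  `Hʲ(S₁) ⊗ Hⁱ(S₂)` into the Künneth piece `H^{j'}(X₁) ⊗ H^{i−2(dim S₂ − dim X₂)}(X₂)` (through the
  characterisation of the pieces by the degrees in which they act,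
  `mem_kunnethPiece_iff_forall_corrAction_eq_zero`; no base change is used).
* §3 **`complexGysin_tensorHom_diagonalClass`** — `(g ⊗ g)_* cl(Δ_X) = Δ_{W*}(g_* 1)`
  (`(g ⊗ g) ∘ Δ_X = Δ_W ∘ g`), `= c · cl(Δ_W)` when `g_* 1 = c · 1`.
* §4 **`kunnethComponents_diagonalClass_complexGysin_tensorHom`** — for `g_* 1 = c · 1`, `c ≠ 0`, and a
  Künneth family `π_X` of `cl(Δ_X)`, the classes `c⁻¹ (g ⊗ g)_* π_X i` form a Künneth family of
  `cl(Δ_W)`; by uniqueness (`kunnethComponents_diagonalClass_unique`) EVERY Künneth family of `cl(Δ_W)`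
  is of this form (`kunnethComponent_diagonalClass_eq_smul_complexGysin_tensorHom`); hence
  **`kunnethComponent_diagonalClass_mem_algebraicClasses_of_surjective`** — **`C(X) ⟹ C(W)` for
  `g : X ⟶ W` surjective with `dim X = dim W`** — and its coniveau form
  `kunnethComponent_diagonalClass_mem_supportedClasses_of_surjective`, the family-free form
  `…_of_surjective_of_forall`, and `exists_complexGysin_one_eq_smul_of_surjective` (`g_* 1 = c · 1`,
  `c ≠ 0`).
* §5 Instances: `C(W)` for `W` dominated equidimensionally by a complex abelian variety
  (`…_of_surjective_abelianVariety`, from the tree's `C(A)`), by a product `X ⊗ Y` with `C(X)`, `C(Y)`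
  (`…_of_surjective_tensor`, from `C(X) ∧ C(Y) ⟹ C(X × Y)`), in particular by a product of two
  varieties of dimension `≤ 2` (`…_of_surjective_tensor_of_le_two`: threefolds and fourfolds dominated
  by products of curves and surfaces).

## References

* [Kahn2020] B. Kahn, Zeta and L-functions of varieties and motives, LMS LN 462, CUP 2020, §6.9
  Def. 6.29, Lemma 6.30 (2) and its proof (p. 125).
* [VoisinHodgeI2002] C. Voisin, Hodge Theory and Complex Algebraic Geometry I, CUP 2002, §7.3.2
  Lemma 7.28, Remark 7.29; §11.3.3 p. 286.
* [Fulton1998] W. Fulton, Intersection Theory, 2nd ed., Springer 1998, §16.1 Def. 16.1.1,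
  Prop. 16.1.1 (b)–(c), Def. 16.1.2, Ex. 16.1.11.
* [FultonYoungTableaux1997] W. Fulton, Young Tableaux, CUP 1997, Appendix B §B.1 (2), (5), (6).
* [Voisin2025] C. Voisin, Hodge and generalized Hodge conjectures, coniveau and algebraic cycles,
  J. Open Math. Probl. 1 (2025), §3.2.1 (12)–(14).
-/

noncomputable section

open CategoryTheory AlgebraicGeometry MonoidalCategory CartesianMonoidalCategory Finset
open Literature.AlgebraicTopology.SingularHomology
open Literature.AlgebraicGeometry.Motives (IsSmoothProjective ComplexPoints)

namespace Literature.AlgebraicGeometry.HodgeTheory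

/-! ### §1 Pushing a correspondence forward along its source factor, and along both factors -/

section Pushforward

variable (μ : OrientationFamily)

/-- **`((W ◁ g)_* γ')_* = γ'_* ∘ g^*`.** For `g : S ⟶ X` between smooth projective varieties of
dimensions `l`, `n`, a smooth projective `W` of dimension `m`, and `γ' ∈ H^{2e'}((W ⊗ S)(ℂ); ℂ)`, the
action of the pushed-forward class `(W ◁ g)_* γ' ∈ H^{2e}((W ⊗ X)(ℂ); ℂ)` (`e' + n = e + l`) on
`c ∈ Hᵃ(X(ℂ))` is `γ'_*(g^* c)`: by the projection formula
`pr_X^* c ∪ (W ◁ g)_* γ' = (W ◁ g)_*((W ◁ g)^* pr_X^* c ∪ γ') = (W ◁ g)_*(pr_S^* (g^* c) ∪ γ')`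
(`(W ◁ g) ≫ pr_X = pr_S ≫ g`), and `pr_{W*} ∘ (W ◁ g)_* = ((W ◁ g) ≫ pr_W)_* = pr_{W*}`. (Fulton: for
`α = Γ_f`, `β ∘ α = (f × 1)^* β`; transposed, `γ' ∘ ᵗΓ_g = (1 × g)_* γ'` acts as `γ'_* ∘ g^*`.)
[cite: Fulton1998, §16.1 Prop. 16.1.1 (b)–(c) and Def. 16.1.2]
[cite: FultonYoungTableaux1997, Appendix B §B.1 (2), (5) and (6)] -/
theorem corrAction_complexGysin_whiskerLeft {m l n : ℕ} {W S X : Motives.SchemeOver ℂ}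
    (hW : IsSmoothProjective m W) (hS : IsSmoothProjective l S) (hX : IsSmoothProjective n X)
    (g : S ⟶ X) {e e' a b : ℕ} (hab' : a + 2 * e' = b + 2 * l) (hab : a + 2 * e = b + 2 * n)
    (hee' : 2 * e' + 2 * (m + n) = 2 * e + 2 * (m + l))
    (γ' : complexBetti (W ⊗ S) (2 * e')) (c : complexBetti X a) :
    corrAction μ hW hX hab
        (complexGysin μ (Motives.IsSmoothProjective.tensor_holds hW hS)
          (Motives.IsSmoothProjective.tensor_holds hW hX) (W ◁ g) hee' γ') c =
      corrAction μ hW hS hab' γ' (complexBetti.map g a c) := by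
  have hμ : μ.HasPoincareDuality := μ.hasPoincareDuality
  have hWS := Motives.IsSmoothProjective.tensor_holds hW hS
  have hWX := Motives.IsSmoothProjective.tensor_holds hW hX
  rw [corrAction_apply, corrAction_apply]
  -- projection formula for `W ◁ g`
  have hproj := complexGysin_cup hμ hWS hWX (W ◁ g) (rfl : a + 2 * e' = a + 2 * e')
    (show (a + 2 * e') + 2 * (m + n) = (a + 2 * e) + 2 * (m + l) by omega) hee'
    (rfl : a + 2 * e = a + 2 * e) (complexBetti.map (snd W X) a c) γ'
  -- `(W ◁ g)^* pr_X^* c = pr_S^* (g^* c)`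
  have hpull : complexBetti.map (W ◁ g) a (complexBetti.map (snd W X) a c) =
      complexBetti.map (snd W S) a (complexBetti.map g a c) := by
    change (complexBetti.map (snd W X) a ≫ complexBetti.map (W ◁ g) a) c =
      (complexBetti.map g a ≫ complexBetti.map (snd W S) a) c
    rw [← complexBetti.map_comp, ← complexBetti.map_comp, whiskerLeft_snd]
  rw [hpull] at hproj
  rw [← hproj, ← LinearMap.comp_apply,
    ← complexGysin_comp hμ hWS hWX hW (W ◁ g) (fst W X)
      (show (a + 2 * e') + 2 * (m + n) = (a + 2 * e) + 2 * (m + l) by omega)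
      (corrAction_degree m hab)]
  -- `(W ◁ g) ≫ pr_W = pr_W`
  have hfst : (W ◁ g) ≫ fst W X = fst W S := whiskerLeft_fst W g
  simp only [hfst]

/-- **`((g₁ ⊗ g₂)_* γ)_* = g₁_* ∘ γ_* ∘ g₂^*`.** For `g₁ : S₁ ⟶ X₁`, `g₂ : S₂ ⟶ X₂` between smooth
projective varieties (dimensions `l₁ → n₁`, `l₂ → n₂`) and `γ ∈ H^{2e'}((S₁ ⊗ S₂)(ℂ); ℂ)`, the pushed
forward class `(g₁ ⊗ g₂)_* γ ∈ H^{2e}((X₁ ⊗ X₂)(ℂ); ℂ)` acts on `c ∈ Hᵃ(X₂(ℂ))` as `g₁_*(γ_*(g₂^* c))`: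
`g₁ ⊗ g₂ = (S₁ ◁ g₂) ≫ (g₁ ▷ X₂)`, functoriality of the Gysin morphisms, §1 and the tree's
`corrAction_complexGysin_whiskerRight`. The intermediate class `(S₁ ◁ g₂)_* γ` lives in degree `2e₁`,
`e' + n₂ = e₁ + l₂` (hypothesis `he₁`). (Fulton: `Γ_{g₁} ∘ γ ∘ ᵗΓ_{g₂} = (g₁ × g₂)_* γ`.)
[cite: Fulton1998, §16.1 Prop. 16.1.1 (b)–(c) and Def. 16.1.2]
[cite: FultonYoungTableaux1997, Appendix B §B.1 (2), (5) and (6)] -/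
theorem corrAction_complexGysin_tensorHom {l₁ l₂ n₁ n₂ : ℕ} {S₁ S₂ X₁ X₂ : Motives.SchemeOver ℂ}
    (hS₁ : IsSmoothProjective l₁ S₁) (hS₂ : IsSmoothProjective l₂ S₂)
    (hX₁ : IsSmoothProjective n₁ X₁) (hX₂ : IsSmoothProjective n₂ X₂)
    (g₁ : S₁ ⟶ X₁) (g₂ : S₂ ⟶ X₂) {e' e₁ e a b' b : ℕ}
    (he₁ : 2 * e' + 2 * (l₁ + n₂) = 2 * e₁ + 2 * (l₁ + l₂))
    (hee' : 2 * e' + 2 * (n₁ + n₂) = 2 * e + 2 * (l₁ + l₂))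
    (hab' : a + 2 * e' = b' + 2 * l₂) (hbb' : b' + 2 * n₁ = b + 2 * l₁)
    (hab : a + 2 * e = b + 2 * n₂)
    (γ : complexBetti (S₁ ⊗ S₂) (2 * e')) (c : complexBetti X₂ a) :
    corrAction μ hX₁ hX₂ hab
        (complexGysin μ (Motives.IsSmoothProjective.tensor_holds hS₁ hS₂)
          (Motives.IsSmoothProjective.tensor_holds hX₁ hX₂) (g₁ ⊗ₘ g₂) hee' γ) c =
      complexGysin μ hS₁ hX₁ g₁ hbb' (corrAction μ hS₁ hS₂ hab' γ (complexBetti.map g₂ a c)) := by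
  have hμ : μ.HasPoincareDuality := μ.hasPoincareDuality
  have hS₁S₂ := Motives.IsSmoothProjective.tensor_holds hS₁ hS₂
  have hS₁X₂ := Motives.IsSmoothProjective.tensor_holds hS₁ hX₂
  have hX₁X₂ := Motives.IsSmoothProjective.tensor_holds hX₁ hX₂
  -- `g₁ ⊗ g₂ = (S₁ ◁ g₂) ≫ (g₁ ▷ X₂)`
  have hfac : g₁ ⊗ₘ g₂ = (S₁ ◁ g₂) ≫ (g₁ ▷ X₂) := tensorHom_def' g₁ g₂
  simp only [hfac]
  rw [complexGysin_comp hμ hS₁S₂ hS₁X₂ hX₁X₂ (S₁ ◁ g₂) (g₁ ▷ X₂) he₁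
      (show 2 * e₁ + 2 * (n₁ + n₂) = 2 * e + 2 * (l₁ + n₂) by omega),
    LinearMap.comp_apply,
    corrAction_complexGysin_whiskerRight μ hS₁ hX₁ hX₂ g₁
      (show a + 2 * e₁ = b' + 2 * n₂ by omega) hab
      (show 2 * e₁ + 2 * (n₁ + n₂) = 2 * e + 2 * (l₁ + n₂) by omega) hbb',
    corrAction_complexGysin_whiskerLeft μ hS₁ hS₂ hX₂ g₂ hab'
      (show a + 2 * e₁ = b' + 2 * n₂ by omega) he₁]

end Pushforward

/-! ### §2 `(g₁ ⊗ g₂)_*` maps Künneth pieces to Künneth pieces -/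

/-- **`(g₁ ⊗ g₂)_* (Hʲ(S₁) ⊗ Hⁱ(S₂)) ⊆ H^{j'}(X₁) ⊗ H^{i'}(X₂)`, `i + 2 dim X₂ = i' + 2 dim S₂`** (for any
orientation family; `dim X₁ ≤ dim S₁`): a class of the piece `Hʲ(S₁) ⊗ Hⁱ(S₂)` acts only on
`H^{2 dim S₂ − i}(S₂)` (`corrAction_eq_zero_of_mem_kunnethPiece_of_ne`), so by §1 its push-forward
`(g₁ ⊗ g₂)_* γ`, acting as `g₁_* ∘ γ_* ∘ g₂^*`, acts only on `H^{2 dim X₂ − i'}(X₂)`, which places it in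
the piece `H^{j'}(X₁) ⊗ H^{i'}(X₂)` (`mem_kunnethPiece_of_forall_corrAction_eq_zero` — the grading of
"`Hᵏ(X) ⊗ Hˡ(Y) ≅ Hom(H^{2n−k}(X), Hˡ(Y))`"). [cite: VoisinHodgeI2002, §11.3.3 p. 286]
[cite: Voisin2025, §3.2.1 (12)–(13)] [cite: Fulton1998, §16.1 Prop. 16.1.1 (c)] -/
theorem complexGysin_tensorHom_mem_kunnethPiece (μ : OrientationFamily) {l₁ l₂ n₁ n₂ : ℕ}
    {S₁ S₂ X₁ X₂ : Motives.SchemeOver ℂ}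
    (hS₁ : IsSmoothProjective l₁ S₁) (hS₂ : IsSmoothProjective l₂ S₂)
    (hX₁ : IsSmoothProjective n₁ X₁) (hX₂ : IsSmoothProjective n₂ X₂)
    (g₁ : S₁ ⟶ X₁) (g₂ : S₂ ⟶ X₂) {e' e₁ e i j i' j' : ℕ}
    (he₁ : 2 * e' + 2 * (l₁ + n₂) = 2 * e₁ + 2 * (l₁ + l₂))
    (hee' : 2 * e' + 2 * (n₁ + n₂) = 2 * e + 2 * (l₁ + l₂)) (hn₁ : n₁ ≤ l₁)
    (hji : j + i = 2 * e') (hji' : j' + i' = 2 * e) (hii' : i' + 2 * l₂ = i + 2 * n₂)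
    {γ : complexBetti (S₁ ⊗ S₂) (2 * e')} (hγ : γ ∈ kunnethPiece S₁ S₂ hji) :
    complexGysin μ (Motives.IsSmoothProjective.tensor_holds hS₁ hS₂)
        (Motives.IsSmoothProjective.tensor_holds hX₁ hX₂) (g₁ ⊗ₘ g₂) hee' γ ∈
      kunnethPiece X₁ X₂ hji' := by
  refine mem_kunnethPiece_of_forall_corrAction_eq_zero μ hX₁ hX₂ hji' fun a b hab hne ↦ ?_
  have hab' : a + 2 * e' = (b + 2 * l₁ - 2 * n₁) + 2 * l₂ := by omega
  ext c
  rw [LinearMap.zero_apply,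
    corrAction_complexGysin_tensorHom μ hS₁ hS₂ hX₁ hX₂ g₁ g₂ he₁ hee' hab'
      (show (b + 2 * l₁ - 2 * n₁) + 2 * n₁ = b + 2 * l₁ by omega) hab,
    corrAction_eq_zero_of_mem_kunnethPiece_of_ne μ hS₁ hS₂ hji hγ hab' (by omega),
    LinearMap.zero_apply, map_zero]

/-! ### §3 `(g ⊗ g)_* cl(Δ_X) = Δ_{W*}(g_* 1)` -/

section Diagonal

variable {n : ℕ} {X W Y : Motives.SchemeOver ℂ}

/-- **`(g ⊗ g)_* cl(Δ_X) = Δ_{W*}(g_* 1)`** for `g : X ⟶ W` between smooth projective varieties of the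
same dimension `n` (complex orientations): `(g ⊗ g)_* Δ_{X*} 1 = (Δ_X ≫ (g ⊗ g))_* 1 = (g ≫ Δ_W)_* 1 =
Δ_{W*}(g_* 1)` (functoriality of the Gysin morphisms and `(g ⊗ g) ∘ Δ_X = Δ_W ∘ g`).
[cite: Fulton1998, §16.1 Prop. 16.1.1 (c) (iii) and Ex. 16.1.11]
[cite: FultonYoungTableaux1997, Appendix B §B.1 (2)] -/
theorem complexGysin_tensorHom_diagonalClass (hX : IsSmoothProjective n X) (hW : IsSmoothProjective n W)
    (g : X ⟶ W) :
    complexGysin complexOrientationFamily (Motives.IsSmoothProjective.tensor_holds hX hX)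
        (Motives.IsSmoothProjective.tensor_holds hW hW) (g ⊗ₘ g)
        (rfl : 2 * n + 2 * (n + n) = 2 * n + 2 * (n + n)) (diagonalClass hX) =
      complexGysin complexOrientationFamily hW (Motives.IsSmoothProjective.tensor_holds hW hW)
        (lift (𝟙 W) (𝟙 W)) (show 0 + 2 * (n + n) = 2 * n + 2 * n by omega)
        (complexGysin complexOrientationFamily hX hW g (rfl : 0 + 2 * n = 0 + 2 * n)
          (singularCohomology.one ℂ (ComplexPoints X))) := by
  have hμ : complexOrientationFamily.HasPoincareDuality := hasPoincareDuality_complexOrientationFamily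
  have hXX := Motives.IsSmoothProjective.tensor_holds hX hX
  have hWW := Motives.IsSmoothProjective.tensor_holds hW hW
  rw [diagonalClass, ← LinearMap.comp_apply,
    ← complexGysin_comp hμ hX hXX hWW (lift (𝟙 X) (𝟙 X)) (g ⊗ₘ g)
      (show 0 + 2 * (n + n) = 2 * n + 2 * n by omega)
      (rfl : 2 * n + 2 * (n + n) = 2 * n + 2 * (n + n))]
  -- `Δ_X ≫ (g ⊗ g) = g ≫ Δ_W`
  have hdiag : lift (𝟙 X) (𝟙 X) ≫ (g ⊗ₘ g) = g ≫ lift (𝟙 W) (𝟙 W) := diagonal_comp_tensorHom g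
  simp only [hdiag]
  rw [complexGysin_comp hμ hX hW hWW g (lift (𝟙 W) (𝟙 W)) (rfl : 0 + 2 * n = 0 + 2 * n)
      (show 0 + 2 * (n + n) = 2 * n + 2 * n by omega), LinearMap.comp_apply]

/-- **`(g ⊗ g)_* cl(Δ_X) = c · cl(Δ_W)` when `g_* 1 = c · 1`** (`dim X = dim W`).
[cite: Fulton1998, §16.1 Prop. 16.1.1 (c) (iii) and Ex. 16.1.11] -/
theorem complexGysin_tensorHom_diagonalClass_of_eq_smul (hX : IsSmoothProjective n X)
    (hW : IsSmoothProjective n W) (g : X ⟶ W) {c : ℂ}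
    (hc : complexGysin complexOrientationFamily hX hW g (rfl : 0 + 2 * n = 0 + 2 * n)
      (singularCohomology.one ℂ (ComplexPoints X)) = c • singularCohomology.one ℂ (ComplexPoints W)) :
    complexGysin complexOrientationFamily (Motives.IsSmoothProjective.tensor_holds hX hX)
        (Motives.IsSmoothProjective.tensor_holds hW hW) (g ⊗ₘ g)
        (rfl : 2 * n + 2 * (n + n) = 2 * n + 2 * (n + n)) (diagonalClass hX) =
      c • diagonalClass hW := by
  rw [complexGysin_tensorHom_diagonalClass, hc, map_smul]
  rfl

/-- **`g_* 1 = c · 1` with `c ≠ 0` for a SURJECTIVE morphism `g : X ⟶ W` of smooth projective varieties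
of the same dimension** (the degree of `g`, for the orientation family `μ`): the tree's
`exists_complexGysin_map_eq_smul_of_surjective` (`g_* g^* = c · Id`, `c ≠ 0`) at `x = 1`, with
`g^* 1 = 1`. [cite: VoisinHodgeI2002, §7.3.2 Remark 7.29]
[cite: FultonYoungTableaux1997, Appendix B §B.1 (6)–(7)] -/
theorem exists_complexGysin_one_eq_smul_of_surjective (μ : OrientationFamily)
    (hX : IsSmoothProjective n X) (hW : IsSmoothProjective n W) (g : X ⟶ W) [Surjective g.left] :
    ∃ c : ℂ, c ≠ 0 ∧
      complexGysin μ hX hW g (rfl : 0 + 2 * n = 0 + 2 * n)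
          (singularCohomology.one ℂ (ComplexPoints X)) =
        c • singularCohomology.one ℂ (ComplexPoints W) := by
  obtain ⟨c, hc0, hc⟩ := exists_complexGysin_map_eq_smul_of_surjective μ hX hW g
  refine ⟨c, hc0, ?_⟩
  have h := hc 0 rfl (singularCohomology.one ℂ (ComplexPoints W))
  rwa [complexBetti.map, singularCohomology.map_one] at h

/-! ### §4 The Künneth components of `cl(Δ_W)` are `c⁻¹ (g ⊗ g)_* π_X i`; `C(X) ⟹ C(W)` -/

section Family

variable {π : Fin (2 * n + 1) → complexBetti (X ⊗ X) (2 * n)}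

/-- **`c⁻¹ (g ⊗ g)_* π_X` is a Künneth family of `cl(Δ_W)`.** For `g : X ⟶ W` of smooth projective
varieties of the same dimension `n` with `g_* 1 = c · 1`, `c ≠ 0`, and a Künneth decomposition
`cl(Δ_X) = Σᵢ π i`, `π i ∈ H^{2n−i}(X) ⊗ Hⁱ(X)`: the classes `c⁻¹ (g ⊗ g)_* π i` lie in the pieces
`H^{2n−i}(W) ⊗ Hⁱ(W)` (§2) and sum to `c⁻¹ (g ⊗ g)_* cl(Δ_X) = cl(Δ_W)` (§3) — "`p p^i_M` is still a
projector; we see immediately that it is `p^i_{M'}`", for the direct summand `h(W)` of `h(X)` cut out by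
`c⁻¹ ᵗΓ_g ∘ Γ_g`. [cite: Kahn2020, §6.9 Lemma 6.30 (2) and its proof]
[cite: VoisinHodgeI2002, §7.3.2 Remark 7.29] -/
theorem kunnethComponents_diagonalClass_complexGysin_tensorHom (hX : IsSmoothProjective n X)
    (hW : IsSmoothProjective n W) (g : X ⟶ W) {c : ℂ} (hc0 : c ≠ 0)
    (hc : complexGysin complexOrientationFamily hX hW g (rfl : 0 + 2 * n = 0 + 2 * n)
      (singularCohomology.one ℂ (ComplexPoints X)) = c • singularCohomology.one ℂ (ComplexPoints W))
    (hπ : ∀ i : Fin (2 * n + 1), π i ∈ kunnethPiece X X (show (2 * n - (i : ℕ)) + i = 2 * n by omega))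
    (hΔ : ∑ i, π i = diagonalClass hX) :
    (∀ i : Fin (2 * n + 1),
        c⁻¹ • complexGysin complexOrientationFamily (Motives.IsSmoothProjective.tensor_holds hX hX)
            (Motives.IsSmoothProjective.tensor_holds hW hW) (g ⊗ₘ g)
            (rfl : 2 * n + 2 * (n + n) = 2 * n + 2 * (n + n)) (π i) ∈
          kunnethPiece W W (show (2 * n - (i : ℕ)) + i = 2 * n by omega)) ∧
      ∑ i, c⁻¹ • complexGysin complexOrientationFamily (Motives.IsSmoothProjective.tensor_holds hX hX)
          (Motives.IsSmoothProjective.tensor_holds hW hW) (g ⊗ₘ g)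
          (rfl : 2 * n + 2 * (n + n) = 2 * n + 2 * (n + n)) (π i) = diagonalClass hW := by
  refine ⟨fun i ↦ Submodule.smul_mem _ _
    (complexGysin_tensorHom_mem_kunnethPiece complexOrientationFamily hX hX hW hW g g
      (e' := n) (e₁ := n) (e := n) rfl rfl le_rfl _ _ rfl (hπ i)), ?_⟩
  rw [← Finset.smul_sum, ← map_sum, hΔ, complexGysin_tensorHom_diagonalClass_of_eq_smul hX hW g hc,
    smul_smul, inv_mul_cancel₀ hc0, one_smul]

variable {πW : Fin (2 * n + 1) → complexBetti (W ⊗ W) (2 * n)}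

/-- **Every Künneth component of `cl(Δ_W)` is `c⁻¹ (g ⊗ g)_*` of the corresponding Künneth component of
`cl(Δ_X)`** (`g : X ⟶ W`, `dim X = dim W`, `g_* 1 = c · 1`, `c ≠ 0`; any two Künneth families): the
family of §4 and uniqueness of the Künneth components (`kunnethComponents_diagonalClass_unique`).
[cite: Kahn2020, §6.9 Lemma 6.30 (2) and its proof] [cite: Voisin2025, §3.2.1 (14)] -/
theorem kunnethComponent_diagonalClass_eq_smul_complexGysin_tensorHom (hX : IsSmoothProjective n X)
    (hW : IsSmoothProjective n W) (g : X ⟶ W) {c : ℂ} (hc0 : c ≠ 0)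
    (hc : complexGysin complexOrientationFamily hX hW g (rfl : 0 + 2 * n = 0 + 2 * n)
      (singularCohomology.one ℂ (ComplexPoints X)) = c • singularCohomology.one ℂ (ComplexPoints W))
    (hπ : ∀ i : Fin (2 * n + 1), π i ∈ kunnethPiece X X (show (2 * n - (i : ℕ)) + i = 2 * n by omega))
    (hΔ : ∑ i, π i = diagonalClass hX)
    (hπW : ∀ i : Fin (2 * n + 1), πW i ∈ kunnethPiece W W (show (2 * n - (i : ℕ)) + i = 2 * n by omega))
    (hΔW : ∑ i, πW i = diagonalClass hW) (i : Fin (2 * n + 1)) :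
    πW i = c⁻¹ • complexGysin complexOrientationFamily (Motives.IsSmoothProjective.tensor_holds hX hX)
        (Motives.IsSmoothProjective.tensor_holds hW hW) (g ⊗ₘ g)
        (rfl : 2 * n + 2 * (n + n) = 2 * n + 2 * (n + n)) (π i) := by
  obtain ⟨hπ', hΔ'⟩ := kunnethComponents_diagonalClass_complexGysin_tensorHom hX hW g hc0 hc hπ hΔ
  exact congrFun (kunnethComponents_diagonalClass_unique hW hπW hΔW hπ' hΔ') i

/-- **Algebraicity descends**: if `g_* 1 = c · 1` with `c ≠ 0` (`g : X ⟶ W`, `dim X = dim W = n`) and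
the Künneth components of `cl(Δ_X)` are algebraic, then every Künneth component of `cl(Δ_W)` is
algebraic: `πW i = c⁻¹ (g ⊗ g)_* π i` and Gysin morphisms preserve algebraic classes
(`complexGysin_mem_algebraicClasses_of_mem_algebraicClasses`).
[cite: Kahn2020, §6.9 Lemma 6.30 (2)] [cite: VoisinHodgeII2003, §9.2.4 Prop. 9.21 (ii)] -/
theorem kunnethComponent_diagonalClass_mem_algebraicClasses_of_complexGysin_one_eq_smul
    (hX : IsSmoothProjective n X) (hW : IsSmoothProjective n W) (g : X ⟶ W) {c : ℂ} (hc0 : c ≠ 0)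
    (hc : complexGysin complexOrientationFamily hX hW g (rfl : 0 + 2 * n = 0 + 2 * n)
      (singularCohomology.one ℂ (ComplexPoints X)) = c • singularCohomology.one ℂ (ComplexPoints W))
    (hπ : ∀ i : Fin (2 * n + 1), π i ∈ kunnethPiece X X (show (2 * n - (i : ℕ)) + i = 2 * n by omega))
    (hΔ : ∑ i, π i = diagonalClass hX) (hC : ∀ i, π i ∈ algebraicClasses (X ⊗ X) n)
    (hπW : ∀ i : Fin (2 * n + 1), πW i ∈ kunnethPiece W W (show (2 * n - (i : ℕ)) + i = 2 * n by omega))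
    (hΔW : ∑ i, πW i = diagonalClass hW) (i : Fin (2 * n + 1)) :
    πW i ∈ algebraicClasses (W ⊗ W) n := by
  rw [kunnethComponent_diagonalClass_eq_smul_complexGysin_tensorHom hX hW g hc0 hc hπ hΔ hπW hΔW i]
  exact Submodule.smul_mem _ _
    (complexGysin_mem_algebraicClasses_of_mem_algebraicClasses complexOrientationFamily
      (Motives.IsSmoothProjective.tensor_holds hX hX) (Motives.IsSmoothProjective.tensor_holds hW hW)
      (g ⊗ₘ g) _ (hC i))

/-- **Coniveau descends**: under the same hypotheses, if `π i ∈ Nʳ H²ⁿ((X ⊗ X)(ℂ))` then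
`πW i ∈ Nʳ H²ⁿ((W ⊗ W)(ℂ))` (Gysin morphisms between varieties of the same dimension preserve the
coniveau, `complexGysin_mem_supportedClasses`). [cite: Kahn2020, §6.9 Lemma 6.30 (2)]
[cite: VoisinHodgeII2003, §9.2.4 Prop. 9.21 (ii)] -/
theorem kunnethComponent_diagonalClass_mem_supportedClasses_of_complexGysin_one_eq_smul
    (hX : IsSmoothProjective n X) (hW : IsSmoothProjective n W) (g : X ⟶ W) {c : ℂ} (hc0 : c ≠ 0)
    (hc : complexGysin complexOrientationFamily hX hW g (rfl : 0 + 2 * n = 0 + 2 * n)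
      (singularCohomology.one ℂ (ComplexPoints X)) = c • singularCohomology.one ℂ (ComplexPoints W))
    (hπ : ∀ i : Fin (2 * n + 1), π i ∈ kunnethPiece X X (show (2 * n - (i : ℕ)) + i = 2 * n by omega))
    (hΔ : ∑ i, π i = diagonalClass hX) {r : Fin (2 * n + 1) → ℕ}
    (hN : ∀ i, π i ∈ supportedClasses (X ⊗ X) (2 * n) (r i))
    (hπW : ∀ i : Fin (2 * n + 1), πW i ∈ kunnethPiece W W (show (2 * n - (i : ℕ)) + i = 2 * n by omega))
    (hΔW : ∑ i, πW i = diagonalClass hW) (i : Fin (2 * n + 1)) :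
    πW i ∈ supportedClasses (W ⊗ W) (2 * n) (r i) := by
  rw [kunnethComponent_diagonalClass_eq_smul_complexGysin_tensorHom hX hW g hc0 hc hπ hΔ hπW hΔW i]
  exact Submodule.smul_mem _ _
    (complexGysin_mem_supportedClasses (gysinMap_restrictCompl_eq_zero_of_field ℂ)
      complexOrientationFamily hasPoincareDuality_complexOrientationFamily
      (Motives.IsSmoothProjective.tensor_holds hX hX) (Motives.IsSmoothProjective.tensor_holds hW hW)
      (g ⊗ₘ g) _ (r := r i) (s := r i) (Nat.add_comm _ _).le (hN i))

/-- **`C(X) ⟹ C(W)` FOR `g : X ⟶ W` SURJECTIVE WITH `dim X = dim W`** (Kahn, Lemma 6.30 (2), for the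
direct summand `h(W) ⊂ h(X)`): if the Künneth components of `cl(Δ_X)` (for one Künneth decomposition
`π`) are algebraic, then every Künneth component of every Künneth decomposition of `cl(Δ_W)` is
algebraic. [cite: Kahn2020, §6.9 Lemma 6.30 (2) and its proof]
[cite: VoisinHodgeI2002, §7.3.2 Lemma 7.28 and Remark 7.29] -/
theorem kunnethComponent_diagonalClass_mem_algebraicClasses_of_surjective (hX : IsSmoothProjective n X)
    (hW : IsSmoothProjective n W) (g : X ⟶ W) [Surjective g.left]
    (hπ : ∀ i : Fin (2 * n + 1), π i ∈ kunnethPiece X X (show (2 * n - (i : ℕ)) + i = 2 * n by omega))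
    (hΔ : ∑ i, π i = diagonalClass hX) (hC : ∀ i, π i ∈ algebraicClasses (X ⊗ X) n)
    (hπW : ∀ i : Fin (2 * n + 1), πW i ∈ kunnethPiece W W (show (2 * n - (i : ℕ)) + i = 2 * n by omega))
    (hΔW : ∑ i, πW i = diagonalClass hW) (i : Fin (2 * n + 1)) :
    πW i ∈ algebraicClasses (W ⊗ W) n := by
  obtain ⟨c, hc0, hc⟩ := exists_complexGysin_one_eq_smul_of_surjective complexOrientationFamily hX hW g
  exact kunnethComponent_diagonalClass_mem_algebraicClasses_of_complexGysin_one_eq_smul hX hW g hc0 hc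
    hπ hΔ hC hπW hΔW i

/-- **Coniveau of the Künneth components descends along surjective equidimensional morphisms**:
`π i ∈ Nʳ⁽ⁱ⁾` for the Künneth components of `cl(Δ_X)` implies `πW i ∈ Nʳ⁽ⁱ⁾` for those of `cl(Δ_W)`.
[cite: Kahn2020, §6.9 Lemma 6.30 (2)] [cite: VoisinHodgeI2002, §7.3.2 Remark 7.29] -/
theorem kunnethComponent_diagonalClass_mem_supportedClasses_of_surjective (hX : IsSmoothProjective n X)
    (hW : IsSmoothProjective n W) (g : X ⟶ W) [Surjective g.left]
    (hπ : ∀ i : Fin (2 * n + 1), π i ∈ kunnethPiece X X (show (2 * n - (i : ℕ)) + i = 2 * n by omega))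
    (hΔ : ∑ i, π i = diagonalClass hX) {r : Fin (2 * n + 1) → ℕ}
    (hN : ∀ i, π i ∈ supportedClasses (X ⊗ X) (2 * n) (r i))
    (hπW : ∀ i : Fin (2 * n + 1), πW i ∈ kunnethPiece W W (show (2 * n - (i : ℕ)) + i = 2 * n by omega))
    (hΔW : ∑ i, πW i = diagonalClass hW) (i : Fin (2 * n + 1)) :
    πW i ∈ supportedClasses (W ⊗ W) (2 * n) (r i) := by
  obtain ⟨c, hc0, hc⟩ := exists_complexGysin_one_eq_smul_of_surjective complexOrientationFamily hX hW g
  exact kunnethComponent_diagonalClass_mem_supportedClasses_of_complexGysin_one_eq_smul hX hW g hc0 hc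
    hπ hΔ hN hπW hΔW i

end Family

/-- **`C(X) ⟹ C(W)` for `g : X ⟶ W` surjective with `dim X = dim W`, family-free form**: if every
Künneth component of every Künneth decomposition of `cl(Δ_X)` is algebraic (Künneth decompositions
exist, `nonempty_kunnethComponents_diagonalClass`), then so is every Künneth component of every Künneth
decomposition of `cl(Δ_W)`. [cite: Kahn2020, §6.9 Lemma 6.30 (2)]
[cite: VoisinHodgeI2002, §7.3.2 Remark 7.29] -/
theorem kunnethComponent_diagonalClass_mem_algebraicClasses_of_surjective_of_forall
    (hX : IsSmoothProjective n X) (hW : IsSmoothProjective n W) (g : X ⟶ W) [Surjective g.left]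
    (hCX : ∀ (πX : Fin (2 * n + 1) → complexBetti (X ⊗ X) (2 * n)),
      (∀ i : Fin (2 * n + 1), πX i ∈ kunnethPiece X X (show (2 * n - (i : ℕ)) + i = 2 * n by omega)) →
      ∑ i, πX i = diagonalClass hX → ∀ i, πX i ∈ algebraicClasses (X ⊗ X) n)
    {πW : Fin (2 * n + 1) → complexBetti (W ⊗ W) (2 * n)}
    (hπW : ∀ i : Fin (2 * n + 1), πW i ∈ kunnethPiece W W (show (2 * n - (i : ℕ)) + i = 2 * n by omega))
    (hΔW : ∑ i, πW i = diagonalClass hW) (i : Fin (2 * n + 1)) :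
    πW i ∈ algebraicClasses (W ⊗ W) n := by
  obtain ⟨⟨πX, hπX, hΔX⟩⟩ := nonempty_kunnethComponents_diagonalClass hX
  exact kunnethComponent_diagonalClass_mem_algebraicClasses_of_surjective hX hW g hπX hΔX
    (hCX πX hπX hΔX) hπW hΔW i

/-! ### §5 Instances: varieties dominated by abelian varieties and by products -/

/-- **`C(W)` for `W` dominated equidimensionally by a complex abelian variety**: for a surjective
`g : A ⟶ W` with `dim W = dim A`, every Künneth component of every Künneth decomposition of `cl(Δ_W)` is
algebraic (the tree's `C(A)`, `AbelianVariety.kunnethComponent_diagonalClass_mem_algebraicClasses`, and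
§4). [cite: Kahn2020, §6.9 Lemma 6.30 (2) and Theorem 6.31 (3)]
[cite: Kleiman1968AlgebraicCycles, §2 Appendix (2A11)] -/
theorem kunnethComponent_diagonalClass_mem_algebraicClasses_of_surjective_abelianVariety
    (A : Motives.AbelianVariety ℂ) (hW : IsSmoothProjective A.dim W) (g : A.X ⟶ W) [Surjective g.left]
    {πW : Fin (2 * A.dim + 1) → complexBetti (W ⊗ W) (2 * A.dim)}
    (hπW : ∀ i : Fin (2 * A.dim + 1), πW i ∈ kunnethPiece W W
      (show (2 * A.dim - (i : ℕ)) + i = 2 * A.dim by omega))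
    (hΔW : ∑ i, πW i = diagonalClass hW) (i : Fin (2 * A.dim + 1)) :
    πW i ∈ algebraicClasses (W ⊗ W) A.dim :=
  kunnethComponent_diagonalClass_mem_algebraicClasses_of_surjective_of_forall
    (Motives.AbelianVariety.isSmoothProjective_holds (A := A)) hW g
    (fun _ hπA hΔA j ↦ A.kunnethComponent_diagonalClass_mem_algebraicClasses hπA hΔA j) hπW hΔW i

variable {m : ℕ}

/-- **`C(W)` for `W` dominated equidimensionally by a product `X ⊗ Y` with `C(X)` and `C(Y)`**
(surjective `g : X ⊗ Y ⟶ W`, `dim W = dim X + dim Y`): `C(X) ∧ C(Y) ⟹ C(X × Y)` (the tree's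
`kunnethComponent_diagonalClass_mem_algebraicClasses_tensor_of_forall`) and §4.
[cite: Kahn2020, §6.9 Lemma 6.30 (2)–(3)] -/
theorem kunnethComponent_diagonalClass_mem_algebraicClasses_of_surjective_tensor
    (hX : IsSmoothProjective m X) (hY : IsSmoothProjective n Y) (hW : IsSmoothProjective (m + n) W)
    (g : X ⊗ Y ⟶ W) [Surjective g.left]
    (hCX : ∀ (πX : Fin (2 * m + 1) → complexBetti (X ⊗ X) (2 * m)),
      (∀ i : Fin (2 * m + 1), πX i ∈ kunnethPiece X X (show (2 * m - (i : ℕ)) + i = 2 * m by omega)) →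
      ∑ i, πX i = diagonalClass hX → ∀ i, πX i ∈ algebraicClasses (X ⊗ X) m)
    (hCY : ∀ (πY : Fin (2 * n + 1) → complexBetti (Y ⊗ Y) (2 * n)),
      (∀ j : Fin (2 * n + 1), πY j ∈ kunnethPiece Y Y (show (2 * n - (j : ℕ)) + j = 2 * n by omega)) →
      ∑ j, πY j = diagonalClass hY → ∀ j, πY j ∈ algebraicClasses (Y ⊗ Y) n)
    {πW : Fin (2 * (m + n) + 1) → complexBetti (W ⊗ W) (2 * (m + n))}
    (hπW : ∀ k : Fin (2 * (m + n) + 1), πW k ∈ kunnethPiece W W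
      (show (2 * (m + n) - (k : ℕ)) + k = 2 * (m + n) by omega))
    (hΔW : ∑ k, πW k = diagonalClass hW) (k : Fin (2 * (m + n) + 1)) :
    πW k ∈ algebraicClasses (W ⊗ W) (m + n) :=
  kunnethComponent_diagonalClass_mem_algebraicClasses_of_surjective_of_forall
    (Motives.IsSmoothProjective.tensor_holds hX hY) hW g
    (fun _ hπ hΔ j ↦
      kunnethComponent_diagonalClass_mem_algebraicClasses_tensor_of_forall hX hY hCX hCY hπ hΔ j)
    hπW hΔW k

/-- **`C(W)` for threefolds and fourfolds (and curves, surfaces) dominated equidimensionally by a product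
of two varieties of dimension `≤ 2`** — e.g. `W` the image of a generically finite surjection from a
product of two surfaces `S × S'`, or from `C × S`: `C` holds in dimension `≤ 2`
(`kunnethComponent_diagonalClass_mem_algebraicClasses_of_le_two`), for products (§3 of
`KunnethStandardConjectureProducts`) and descends (§4).
[cite: Kahn2020, §6.9 Lemma 6.30 (2)–(3) and Theorem 6.31 (1)–(2)] [cite: Voisin2025, §3.2.1 Cor. 3.9] -/
theorem kunnethComponent_diagonalClass_mem_algebraicClasses_of_surjective_tensor_of_le_two
    (hX : IsSmoothProjective m X) (hY : IsSmoothProjective n Y) (hm : m ≤ 2) (hn : n ≤ 2)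
    (hW : IsSmoothProjective (m + n) W) (g : X ⊗ Y ⟶ W) [Surjective g.left]
    {πW : Fin (2 * (m + n) + 1) → complexBetti (W ⊗ W) (2 * (m + n))}
    (hπW : ∀ k : Fin (2 * (m + n) + 1), πW k ∈ kunnethPiece W W
      (show (2 * (m + n) - (k : ℕ)) + k = 2 * (m + n) by omega))
    (hΔW : ∑ k, πW k = diagonalClass hW) (k : Fin (2 * (m + n) + 1)) :
    πW k ∈ algebraicClasses (W ⊗ W) (m + n) :=
  kunnethComponent_diagonalClass_mem_algebraicClasses_of_surjective_tensor hX hY hW g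
    (fun _ hπX hΔX i ↦ kunnethComponent_diagonalClass_mem_algebraicClasses_of_le_two hX hm hπX hΔX i)
    (fun _ hπY hΔY j ↦ kunnethComponent_diagonalClass_mem_algebraicClasses_of_le_two hY hn hπY hΔY j)
    hπW hΔW k

/-- **`C(W)` for `W` dominated equidimensionally by `A ⊗ Y`, `A` a complex abelian variety and `C(Y)`**
(e.g. `A × S` for a surface `S` mapping onto `W`). [cite: Kahn2020, §6.9 Lemma 6.30 (2)–(3) and Theorem 6.31 (3)] -/
theorem kunnethComponent_diagonalClass_mem_algebraicClasses_of_surjective_abelianVariety_tensor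
    (A : Motives.AbelianVariety ℂ) (hY : IsSmoothProjective n Y)
    (hCY : ∀ (πY : Fin (2 * n + 1) → complexBetti (Y ⊗ Y) (2 * n)),
      (∀ j : Fin (2 * n + 1), πY j ∈ kunnethPiece Y Y (show (2 * n - (j : ℕ)) + j = 2 * n by omega)) →
      ∑ j, πY j = diagonalClass hY → ∀ j, πY j ∈ algebraicClasses (Y ⊗ Y) n)
    (hW : IsSmoothProjective (A.dim + n) W) (g : A.X ⊗ Y ⟶ W) [Surjective g.left]
    {πW : Fin (2 * (A.dim + n) + 1) → complexBetti (W ⊗ W) (2 * (A.dim + n))}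
    (hπW : ∀ k : Fin (2 * (A.dim + n) + 1), πW k ∈ kunnethPiece W W
      (show (2 * (A.dim + n) - (k : ℕ)) + k = 2 * (A.dim + n) by omega))
    (hΔW : ∑ k, πW k = diagonalClass hW) (k : Fin (2 * (A.dim + n) + 1)) :
    πW k ∈ algebraicClasses (W ⊗ W) (A.dim + n) :=
  kunnethComponent_diagonalClass_mem_algebraicClasses_of_surjective_tensor
    (Motives.AbelianVariety.isSmoothProjective_holds (A := A)) hY hW g
    (fun _ hπA hΔA i ↦ A.kunnethComponent_diagonalClass_mem_algebraicClasses hπA hΔA i) hCY hπW hΔW k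

end Diagonal

end Literature.AlgebraicGeometry.HodgeTheory

end
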